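import Mathlib
import HarnessLib

/-!
# `CurvatureKernelBound` — tempered renormalisations are sub-exponential along a subsequence
# (support for stmt-QuantumFields-11687, line `coupling-trichotomy`, stub `TemperedSubsequence`)

Crux `stmt-QuantumFields-11687` (`PencilRigidity.CurvatureKernelBound`), line `coupling-trichotomy`, stub
`TemperedSubsequence`.

`a k > 0` are lattice spacings tending to `0`, `c k` the multiplicative renormalisation of the plaquette field along a
scaling scheme. "Tempered" means: frequently `c_k² e^{−δ₀/a_k} ≤ 1`. Along the strictly increasing extraction `φ` of
these indices (`Filter.extraction_of_frequently_atTop`), for every `δ > δ₀`,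
`c² e^{−δ/a} = (c² e^{−δ₀/a}) · e^{−(δ−δ₀)/a} ≤ e^{−(δ−δ₀)/a} → 0`, because `a ∘ φ → 0⁺`. [folklore]
-/

namespace Summit.QuantumFields.YangMills.Theorems.CurvatureKernel

open Filter
open scoped Topology

/-- If `a_k → 0⁺` then `e^{−ε/a_k} → 0` for every `ε > 0`. [folklore] -/
theorem tendsto_exp_neg_div_tempered {a : ℕ → ℝ} (ha0 : ∀ k, 0 < a k) (ha : Tendsto a atTop (𝓝 0))
    {ε : ℝ} (hε : 0 < ε) : Tendsto (fun k => Real.exp (-(ε / a k))) atTop (𝓝 0) := by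
  have hinv : Tendsto (fun k => (a k)⁻¹) atTop atTop :=
    (tendsto_nhdsWithin_iff.2 ⟨ha, Eventually.of_forall fun k => ha0 k⟩).inv_tendsto_nhdsGT_zero
  refine (Real.tendsto_exp_neg_atTop_nhds_zero.comp (hinv.const_mul_atTop hε)).congr fun k => ?_
  simp only [Function.comp_apply, div_eq_mul_inv]

/-- Pointwise splitting bound: if `c² e^{−δ₀/x} ≤ 1` then `c² e^{−δ/x} ≤ e^{−(δ−δ₀)/x}`. [folklore] -/
theorem sq_mul_exp_neg_div_le_tempered {c x δ₀ δ : ℝ} (h : c ^ 2 * Real.exp (-(δ₀ / x)) ≤ 1) :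
    c ^ 2 * Real.exp (-(δ / x)) ≤ Real.exp (-((δ - δ₀) / x)) := by
  have hsplit : Real.exp (-(δ / x)) = Real.exp (-(δ₀ / x)) * Real.exp (-((δ - δ₀) / x)) := by
    rw [← Real.exp_add]
    congr 1
    ring
  calc c ^ 2 * Real.exp (-(δ / x))
      = (c ^ 2 * Real.exp (-(δ₀ / x))) * Real.exp (-((δ - δ₀) / x)) := by rw [hsplit, mul_assoc]
    _ ≤ 1 * Real.exp (-((δ - δ₀) / x)) := mul_le_mul_of_nonneg_right h (Real.exp_pos _).le
    _ = Real.exp (-((δ - δ₀) / x)) := one_mul _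

/-- **Stub `TemperedSubsequence`** (registered signature verbatim). If the lattice spacings `a_k > 0` tend to `0` and the
renormalisation is tempered at rate `δ₀` — frequently `c_k² e^{−δ₀/a_k} ≤ 1` — then along a strictly increasing
subsequence `φ` one has `c_{φ k}² e^{−δ/a_{φ k}} → 0` for EVERY `δ > δ₀`. [folklore] -/
theorem TemperedSubsequence : ∀ (a c : ℕ → ℝ), (∀ k, 0 < a k) → Filter.Tendsto a Filter.atTop (nhds 0) → ∀ δ₀ : ℝ, (∃ᶠ k in Filter.atTop, c k ^ 2 * Real.exp (-(δ₀ / a k)) ≤ 1) → ∃ φ : ℕ → ℕ, StrictMono φ ∧ ∀ δ : ℝ, δ₀ < δ → Filter.Tendsto (fun k : ℕ => c (φ k) ^ 2 * Real.exp (-(δ / a (φ k)))) Filter.atTop (nhds 0) := by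
  intro a c ha0 ha δ₀ hfreq
  obtain ⟨φ, hφ, hle⟩ := Filter.extraction_of_frequently_atTop hfreq
  refine ⟨φ, hφ, fun δ hδ => ?_⟩
  have haφ : Tendsto (fun k => a (φ k)) atTop (𝓝 0) := ha.comp hφ.tendsto_atTop
  have hg : Tendsto (fun k => Real.exp (-((δ - δ₀) / a (φ k)))) atTop (𝓝 0) :=
    tendsto_exp_neg_div_tempered (a := fun k => a (φ k)) (fun k => ha0 (φ k)) haφ (sub_pos.2 hδ)
  exact squeeze_zero (fun k => by positivity) (fun k => sq_mul_exp_neg_div_le_tempered (hle k)) hg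

end Summit.QuantumFields.YangMills.Theorems.CurvatureKernel
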